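import Literature.AnabelianGeometry.EtaleTheta.Discharge.Sec3Cor38CriterionToyGenuine
import HarnessLib

/-!
# [EtTh] Cor. 3.8 proof, row C38-L05 (`BsFldPreStepLimitCriterion`): the typed row is INDEPENDENT of the typed
# interface — universal closure over ALL binders refuted, both truth values realised (FACT-LIST F-2807 bookkeeping)

S. Mochizuki, *The étale theta function …*, Publ. RIMS **45** (2009) [MochizukiEtTh2009], proof of Cor. 3.8, PDF p.81
l.20–27 ("a pre-step of `C_i` is base-field-theoretic if and only if its image `A → B` in `C_i^pf` may be written
as a [filtered] projective limit … of pre-steps `A' → B` that are abstractly equivalent to an endomorphism that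
belongs to '`O^▷(−)`'") [cite: MochizukiEtTh2009, Cor 3.8 p.81].

PROOF-ONLY census sheet (abc-iut cell, block F fact-proving wave, seat abc-iut-f-132; FACT-LIST row F-2807
`TemperedFrobenioid.BsFldPreStepLimitCriterion`, kernel_closedness = parametrised).  Nothing new is constructed: the
two kernel events the row needs are ALREADY in the tree and are only put side by side in the shape the FACT-LIST
fold reads —
* abc-iut-w5-d124's `ℤ_{≥0}³` countermodel `Cor38Toy.C` (`Sec3Cor38CriterionToy`, p425444: a Frobenioid-certified
  tempered Frobenioid over the all-`True` vocabularies at which the criterion FAILS for THE perfection,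
  `Cor38Toy.not_bsFldPreStepLimitCriterion`; their `not_forall_…` quantifies over `(T, C, hF)` at fixed vocabularies);
* abc-iut-w5-d164's `Toy.bsFldPreStepLimitCriterion_genuine` (`Sec3Cor38CriterionToyGenuine`): the criterion HOLDS
  with NO binder at the genuine-vocabulary, Frobenioid-certified `Toy.genuineTemperedFrobenioid`.
Recorded here: `TemperedFrobenioid.not_forall_bsFldPreStepLimitCriterion_univ` — the universal closure over the
decl's FULL binder list `(D₀, V, T, D, VD, C, P)` is FALSE (R5: the row is admissible at named instances only);
`TemperedFrobenioid.bsFldPreStepLimitCriterion_independent` — both truth values are realised by constructed,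
Frobenioid-certified tempered Frobenioids at THE [FrdI] perfection, so the row is not decidable from the typed
interface `TemperedFrobenioid` + `IsFrobenioid` alone (the positive general theorem
`bsFldPreStepLimitCriterion_of_coord'`, `Sec3Cor38CriterionCoord`, therefore keeps its printed binders).
HONEST FRAMING: bookkeeping over existing kernel objects; degenerate toys; nothing here bears on [IUTchIII] Cor. 3.12;
refuting OUR closure ≠ refuting print (print asserts the instance at the tempered Frobenioids of [EtTh] §3–§5).
-/

namespace Literature.AnabelianGeometry.EtaleTheta

open CategoryTheory Opposite Literature.AlgebraicGeometry.Frobenioids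

namespace TemperedFrobenioid

/-- **The universal closure of row C38-L05 over ALL its binders is false** (base data `D₀`, monoid vocabulary `V`,
realified data `T`, base category `D`, category vocabulary `VD`, tempered Frobenioid `C`, perfection datum `P`):
witnessed by abc-iut-w5-d124's `Cor38Toy` at THE perfection of its Frobenioid. [cite: MochizukiEtTh2009, Cor 3.8 p.81] -/
theorem not_forall_bsFldPreStepLimitCriterion_univ :
    ¬ ∀ (D₀ : Type) (_ : Category.{0} D₀) (V : FrdIMonoidStub.{0}) (T : RealifiedDivisorMonoids (D₀ := D₀) V)
        (D : Type) (_ : Category.{0} D) (VD : FrdICatStub.{0, 0, 0} D) (C : TemperedFrobenioid T D VD)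
        (P : PerfectionData C.opsData), C.BsFldPreStepLimitCriterion P :=
  fun h => Cor38Toy.not_bsFldPreStepLimitCriterion
    (h _ _ _ _ _ _ _ Cor38Toy.C (PreFrobenioidData.perfection Cor38Toy.isFrobenioid))

/-- … already over THE [FrdI] perfection attached to a Frobenioid certificate (the shape every consumer uses):
`¬ ∀ … (C) (hF : IsFrobenioid C.toElem), C.BsFldPreStepLimitCriterion (perfection hF)`.
[cite: MochizukiEtTh2009, Cor 3.8 p.81] -/
theorem not_forall_bsFldPreStepLimitCriterion_perfection :
    ¬ ∀ (D₀ : Type) (_ : Category.{0} D₀) (V : FrdIMonoidStub.{0}) (T : RealifiedDivisorMonoids (D₀ := D₀) V)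
        (D : Type) (_ : Category.{0} D) (VD : FrdICatStub.{0, 0, 0} D) (C : TemperedFrobenioid T D VD)
        (hF : PreFrobenioid.IsFrobenioid C.toElem),
        C.BsFldPreStepLimitCriterion (PreFrobenioidData.perfection hF) :=
  fun h => Cor38Toy.not_bsFldPreStepLimitCriterion (h _ _ _ _ _ _ _ Cor38Toy.C Cor38Toy.isFrobenioid)

/-- **Row C38-L05 is INDEPENDENT of the typed interface**: there are constructed, Frobenioid-certified tempered
Frobenioids at whose [FrdI] perfection the criterion HOLDS (abc-iut-w5-d164's genuine-vocabulary toy, no binder)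
and ones at whose perfection it FAILS (abc-iut-w5-d124's `ℤ_{≥0}³` toy). [cite: MochizukiEtTh2009, Cor 3.8 p.81] -/
theorem bsFldPreStepLimitCriterion_independent :
    (∃ (D₀ : Type) (_ : Category.{0} D₀) (V : FrdIMonoidStub.{0}) (T : RealifiedDivisorMonoids (D₀ := D₀) V)
        (D : Type) (_ : Category.{0} D) (VD : FrdICatStub.{0, 0, 0} D) (C : TemperedFrobenioid T D VD)
        (hF : PreFrobenioid.IsFrobenioid C.toElem),
        C.BsFldPreStepLimitCriterion (PreFrobenioidData.perfection hF)) ∧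
    (∃ (D₀ : Type) (_ : Category.{0} D₀) (V : FrdIMonoidStub.{0}) (T : RealifiedDivisorMonoids (D₀ := D₀) V)
        (D : Type) (_ : Category.{0} D) (VD : FrdICatStub.{0, 0, 0} D) (C : TemperedFrobenioid T D VD)
        (hF : PreFrobenioid.IsFrobenioid C.toElem),
        ¬ C.BsFldPreStepLimitCriterion (PreFrobenioidData.perfection hF)) :=
  ⟨⟨_, _, _, _, _, _, _, Toy.genuineTemperedFrobenioid (fun _ => True) (fun _ => True),
      Toy.isFrobenioid_genuineTemperedFrobenioid _ _, Toy.bsFldPreStepLimitCriterion_genuine _ _⟩,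
    ⟨_, _, _, _, _, _, _, Cor38Toy.C, Cor38Toy.isFrobenioid, Cor38Toy.not_bsFldPreStepLimitCriterion⟩⟩

end TemperedFrobenioid

end Literature.AnabelianGeometry.EtaleTheta
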